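import Literature.MathematicalPhysics.StatisticalMechanics.HardSphereContactTheoremProofs
import Summits.AtomisticToContinuum.HydrodynamicLimit.Theorems.CollisionIsometryCLTCollisionalTransferLocalityCompressibilityLinear
import HarnessLib

/-!
# The compressibility factor is continuous at small density

Helper file (`--supports stmt-AtomisticToContinuum-9518`, line `hemisphere-affine-slaving`) for the
registered stub [Zc] `hsCompressibility_continuousOn` of the crux `CollisionalTransferLocality`:
there is `η_c > 0` such that `Z = hsCompressibility`, `Z(η) = 1 + η f_ex'(η)`, is continuous on
`[0, η_c]`.

Proof: below the cluster radius `σ₁ := min σ₀ (1/4)` of `HardSphereContactTheoremProofs`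
(`exists_smallDensity`) the tree proves `HasDerivAt f_ex (Λ(σ³)) (σ³)` for `0 < σ < σ₁`
(`hasDerivAt_hsExcessFreeEnergy`), with `Λ` continuous there (`continuousAt_Lam`). Hence on the
open interval `(0, σ₁³)` one has `f_ex' = Λ` pointwise, so `f_ex'` agrees with the continuous `Λ`
near every point of `(0, σ₁³)` and `Z` is continuous at every such point. At `η = 0`, `Z(0) = 1`
and the linear bound `|Z(η) − 1| ≤ K η` on `[0, η_Z]` (`stub_hsCompressibility_linear`) squeezes
`Z(η) → 1` within `[0, η_c]`, `η_c := min ((σ₁/2)³) η_Z`. No dynamics, no probability here.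
-/

namespace Summit.AtomisticToContinuum.HydrodynamicLimit.Theorems.HemisphereAffineSlaving

open scoped BigOperators Topology Classical ENNReal InnerProductSpace
open Filter Set Function MeasureTheory

noncomputable section

open Literature.MathematicalPhysics.KineticTheory (T3 V3)
open Literature.MathematicalPhysics.KineticTheory (hsExcessFreeEnergy hsCompressibility
  uniformProfile SmallDensity exists_smallDensity)
open Literature.MathematicalPhysics.StatisticalMechanics (hasDerivAt_hsExcessFreeEnergy
  continuousAt_Lam Lam pow_three_rpow_third rpow_third_pow_three)

/-- **[Zc] The compressibility factor is continuous at small density** (registered stub of the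
crux `CollisionalTransferLocality`, stmt-AtomisticToContinuum-9518, line
hemisphere-affine-slaving): there is `η_c > 0` with `Z = hsCompressibility` continuous on
`[0, η_c]`. With the cluster radius `σ₁` of the contact theorem, `f_ex' = Λ` on the open interval
`(0, σ₁³)` (`hasDerivAt_hsExcessFreeEnergy`) and `Λ` is continuous there (`continuousAt_Lam`), so
`Z(η) = 1 + η f_ex'(η)` is continuous at every `η ∈ (0, σ₁³)`; at `η = 0`, `Z(0) = 1` and
`|Z(η) − 1| ≤ K η` on `[0, η_Z]` (`stub_hsCompressibility_linear`) gives continuity within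
`[0, η_c]`, `η_c := min ((σ₁/2)³) η_Z`. [folklore] -/
theorem hsCompressibility_continuousOn : ∃ ηc : ℝ, 0 < ηc ∧ ContinuousOn Literature.MathematicalPhysics.KineticTheory.hsCompressibility (Icc 0 ηc) := by
  obtain ⟨σ₀, hσ₀, hsd0⟩ := exists_smallDensity uniformProfile one_pos
  set σ₁ := min σ₀ (1 / 4 : ℝ)
  have hsd : ∀ σ, 0 < σ → σ < σ₁ → SmallDensity uniformProfile σ := fun σ h0 h1 =>
    (hsd0 σ h0 (h1.trans_le (min_le_left _ _))).1
  have hσ₁4 : σ₁ ≤ 1 / 4 := min_le_right _ _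
  have hσ₁1 : σ₁ ≤ 1 := hσ₁4.trans (by norm_num)
  have hσ₁0 : 0 < σ₁ := lt_min hσ₀ (by norm_num)
  -- below `σ₁³` the reduced diameter `η^{1/3}` lies below the cluster radius
  have hroot : ∀ η : ℝ, 0 < η → η < σ₁ ^ 3 → η ^ (1 / 3 : ℝ) < σ₁ := fun η h0 h1 => by
    have h := Real.rpow_lt_rpow h0.le h1 (by norm_num : (0 : ℝ) < 1 / 3)
    rwa [pow_three_rpow_third hσ₁0.le] at h
  -- `f_ex' = Λ` on the open interval `(0, σ₁³)`
  have hderiv : ∀ η ∈ Ioo 0 (σ₁ ^ 3), deriv hsExcessFreeEnergy η = Lam η := by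
    intro η hη
    have hD := hasDerivAt_hsExcessFreeEnergy hσ₁4 hsd (Real.rpow_pos_of_pos hη.1 _)
      (hroot η hη.1 hη.2)
    rw [rpow_third_pow_three hη.1.le] at hD
    exact hD.deriv
  -- the linear bound at the origin
  obtain ⟨ηZ, hηZ, K, hK, hlin⟩ := stub_hsCompressibility_linear
  have hhalf : (σ₁ / 2) ^ 3 < σ₁ ^ 3 := pow_lt_pow_left₀ (by linarith) (by positivity) (by norm_num)
  refine ⟨min ((σ₁ / 2) ^ 3) ηZ, lt_min (by positivity) hηZ, fun x hx => ?_⟩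
  rcases hx.1.eq_or_lt with h0 | hxpos
  · -- continuity within `[0, η_c]` at `η = 0`: squeeze by the linear bound
    subst h0
    rw [Metric.continuousWithinAt_iff]
    intro ε hε
    have hK1 : 0 < K + 1 := by linarith
    refine ⟨ε / (K + 1), by positivity, fun y hy hyd => ?_⟩
    have hy0 : 0 ≤ y := hy.1
    have hyZ : y ≤ ηZ := hy.2.trans (min_le_right _ _)
    have hyδ : y < ε / (K + 1) := by
      rwa [Real.dist_eq, sub_zero, abs_of_nonneg hy0] at hyd
    have hZ0 : hsCompressibility 0 = 1 := by
      simp [Literature.MathematicalPhysics.KineticTheory.hsCompressibility]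
    rw [Real.dist_eq, hZ0]
    calc |hsCompressibility y - 1| ≤ K * y := hlin y hy0 hyZ
      _ ≤ (K + 1) * y := by nlinarith
      _ < (K + 1) * (ε / (K + 1)) := mul_lt_mul_of_pos_left hyδ hK1
      _ = ε := by field_simp
  · -- continuity at a point `0 < x ≤ (σ₁/2)³ < σ₁³` of the open interval
    have hxlt : x < σ₁ ^ 3 := (hx.2.trans (min_le_left _ _)).trans_lt hhalf
    have hev : Lam =ᶠ[𝓝 x] deriv hsExcessFreeEnergy := by
      filter_upwards [Ioo_mem_nhds hxpos hxlt] with η hη using (hderiv η hη).symm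
    have hd : ContinuousAt (deriv hsExcessFreeEnergy) x :=
      (continuousAt_Lam hsd hσ₁1 hxpos (hroot x hxpos hxlt)).congr hev
    have hZ : ContinuousAt hsCompressibility x := by
      have e : hsCompressibility = fun η => 1 + η * deriv hsExcessFreeEnergy η := rfl
      rw [e]
      exact continuousAt_const.add (continuousAt_id.mul hd)
    exact hZ.continuousWithinAt

end

end Summit.AtomisticToContinuum.HydrodynamicLimit.Theorems.HemisphereAffineSlaving
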